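import Literature.Probability.FitznerVanDerHofstad2017.NobleBoundsNEndC1
import Literature.Probability.FitznerVanDerHofstad2017.NobleBoundsN1Cls02DoublePrime
import HarnessLib

/-!
# Fitzner–van der Hofstad (2017), §6.1 (6.4) at the last junction of an `N ≥ 2` diagram, against `Ā''`

[FvdH17] = R. Fitzner, R. van der Hofstad, *Mean-field behavior for nearest-neighbor percolation in `d > 10`*,
Electron. J. Probab. **22** (2017), no. 43, arXiv:1506.07977v2; §6.1 proof of Lemma 5.3 (pp. 58–59), "Case
`a = 0, b ≥ 2`" (p. 59): the middle letter of the last junction in class `(a, b) = (0, 2)` is the REPULSIVE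
`𝓣_{1,1̲,0}(u−z, u+e_ι−z, t−z)`.

The terminal packages of `NobleBoundsNEnd` / `NobleBoundsNEndC1` bound the last junction of an `N = M + 2`
diagram by `starA (Ā') (secEA Ā' 2)^{κ,a,c}(u,w,t,z) · starS (P^E) (c) (t−x, z−x)` with the App.-B-typed family
`Ā' = blockAbar'`.  This module gives the SAME packages against the additive family `Ā'' = blockAbar''` of
`NobleBlocksDoublePrime` (row `(0,2)` repulsive, every other row `= Ā'` by `blockAbar''_of_ne`): the rows
`c = 0`, `c = 1`, the `★`-row and the `★`-column transfer by rewriting (`blockAbar''_of_ne`, `secEA_blockAbar''_two`);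
the row `c = 2` is re-proved along `NobleBoundsNEnd.nonempty_jPkg_end_two` with the single changed letter supplied
by `NobleBoundsN1Cls02DoublePrime.piPerc_mid_zero_two_le_blockAbar''`.  The dispatcher
`nonempty_jPkg_end_starA''` is the `pkg` input of the chain inequality at the last junction for the `Ā''` tables.
Unconditional, every `d` and `p`; nothing landed is changed.
-/

namespace Literature.Probability.FitznerVanDerHofstad2017

open Literature.Barriers.CriticalPhenomena Literature.Probability.Percolation
open Literature.Probability.LatticeModels Literature.Combinatorics.SimpleGraph _root_.SimpleGraph
open _root_.MeasureTheory
open Literature.Probability.FitznerVanDerHofstad2017.NobleBlocks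
open Literature.Probability.FitznerVanDerHofstad2017.NobleBlocks.LenIdx
open scoped ENNReal

variable {d : ℕ}

/-- The `z = w` section of the row `a = 2` does not see the row `(0,2)`: `secEA Ā'' 2 = secEA Ā' 2`.
[cite: FitznerVanDerHofstad2017, §5.1 (5.4) and "Elements of the bounds" (arXiv:1506.07977v2 pp. 48–49)] -/
theorem secEA_blockAbar''_two (L : Letters d) :
    BlockSummation.secEA (blockAbar'' L) 2 = BlockSummation.secEA (blockAbar' L) 2 := by
  funext κ c u w t
  simp only [BlockSummation.secEA, blockAbar''_of_ne L κ (show ¬((2 : Fin 3) = 0 ∧ c = 2) by simp)]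

section EndJunction

variable (p : unitInterval) (M : ℕ) (x : Site d) (b : Fin (M + 2) → Site d × Site d) (w t z : Fin (M + 2) → Site d)
  (a : Fin (M + 2) → Fin 3 ⊕ Unit) (c : Fin 3 ⊕ Unit) (τ : Fin (M + 1) → Bool × Fin 3)


/-- **Rows `(a, 2)` of the terminal block against `Ā''`**: the package of the last junction with target
`Ā''^{κ,a,2}(u,w,t,z) · P^{E,2}(t−x, z−x)`; the proof of `NobleBoundsNEnd.nonempty_jPkg_end_two` with the letter of
row `(0,2)` replaced by the repulsive one (`piPerc_mid_zero_two_le_blockAbar''`), rows `(1,2)`, `(2,2)` unchanged.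
[cite: FitznerVanDerHofstad2017, §6.1 "Case a = 0 / a = 1 / a ≥ 2", "Case a = 0, b ≥ 2" (arXiv:1506.07977v2 pp. 58–59); App. B (p. 78); (4.29) (p. 38)] -/
theorem nonempty_jPkg_end_two'' (κ : Fin d × Bool)
    (hb : (b (Fin.last (M + 1))).2 = (b (Fin.last (M + 1))).1 + stepVec κ) (a₀ : Fin 3)
    (ha : a (Fin.last (M + 1)) = Sum.inl a₀) (hc : c = Sum.inl 2) :
    Nonempty (JPkg p (jctx M x b w t z a τ (Fin.last (M + 1))) (JFacts M x b w t z a c τ)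
      (blockAbar'' (Letters.perc d p) κ a₀ 2 (b (Fin.last (M + 1))).1 (w (Fin.last (M + 1))) (t (Fin.last (M + 1)))
          (z (Fin.last (M + 1))) *
        blockPE (Letters.perc d p) 2 (t (Fin.last (M + 1)) - x) (z (Fin.last (M + 1)) - x))) := by
  -- degenerate parameters: the piece is empty
  by_cases hP : t (Fin.last (M + 1)) ≠ z (Fin.last (M + 1)) ∧ t (Fin.last (M + 1)) ≠ x ∧ z (Fin.last (M + 1)) ≠ x ∧
      (b (Fin.last (M + 1))).1 ≠ z (Fin.last (M + 1)) ∧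
      (a₀ = 0 → w (Fin.last (M + 1)) = (b (Fin.last (M + 1))).1) ∧ (a₀ = 1 → (zdGraph d).Adj (b (Fin.last (M + 1))).1 (w (Fin.last (M + 1))))
  swap
  · refine ⟨JPkg.vacuous p _ _ (fun ω K₀ hF => hP ?_) _⟩
    have htz := hF.t_ne_z_of_last_ne_zero hc (by decide)
    have hx := hF.t_ne_x_and_z_ne_x htz
    refine ⟨htz, hx.1, hx.2, hF.lastLevel.2.2.1, fun h0 => hF.w_eq_of_exit_zero (ha.trans (by rw [h0])),
      fun h1 => hF.adj_of_exit_one (ha.trans (by rw [h1]))⟩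
  obtain ⟨htz, htx, hzx, huz, hw0, hw1⟩ := hP
  have huv : (b (Fin.last (M + 1))).1 ≠ (b (Fin.last (M + 1))).2 := by
    rw [hb]; exact (zdGraph_adj_iff_stepVec _ _ |>.2 ⟨κ, rfl⟩).ne
  refine nonempty_jPkg_end_of p
    (endEv (event (eq 1) (b (Fin.last (M + 1))).1 (b (Fin.last (M + 1))).2) (event (ge 0) (b (Fin.last (M + 1))).2 (t (Fin.last (M + 1))))
      (endX a₀ (b (Fin.last (M + 1))).1 (w (Fin.last (M + 1))) (z (Fin.last (M + 1))))
      (event (ge 2) (t (Fin.last (M + 1))) (z (Fin.last (M + 1)))) (event (ge 1) x (t (Fin.last (M + 1)))) (event (ge 1) (z (Fin.last (M + 1))) x))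
    (isFinitary_endEv _ _ _ _ _ _ (isFinitary_event _ _ _) (isFinitary_event _ _ _) (isFinitary_endX _ _ _ _)
      (isFinitary_event _ _ _) (isFinitary_event _ _ _) (isFinitary_event _ _ _))
    (by rw [endEv_xb]; exact singleton_mem_event_eq_one huv) (fun ω K₀ hF => ⟨fun a₁ _ => ?_, fun j hj => ?_⟩) ?_
  · -- the exit witness lies in the exit-line event
    rw [endEv_lo_five]
    have h5 := hF.conn_lo_five ha
    unfold endX
    split_ifs with h0
    · rw [hw0 h0] at h5
      rw [event_comm, event_ge]
      exact mem_openConnGe_one_of_ne h5 huz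
    · rw [event_comm, event_ge]
      exact mem_openConnGe_zero_of_mem h5
  · -- the witnesses of the last level lie in the upgraded events
    obtain ⟨h0, h1, h2, h3⟩ := hF.conn_last
    refine mem_endEv_up _ _ _ _ _ _ ?_ ?_ ?_ ?_ j hj
    · rw [event_ge]; exact mem_openConnGe_zero_of_mem h0
    · rw [event_ge]
      exact mem_openConnGe_two_of_notMem h1 htz fun hm => (hF.last_two hc).2 (hF.subset_last 1 hm)
    · rw [event_comm, event_ge]; exact mem_openConnGe_one_of_ne h2 htx
    · rw [event_ge]; exact mem_openConnGe_one_of_ne h3 hzx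
  · -- the two letters
    refine mul_le_mul' ((endF_xb_le p M x b w t z a τ ha false _).trans ?_)
      ((endF_up_one_le p M x b w t z a τ false _).trans ?_)
    · rw [endEv_xb, endEv_up_zero, endEv_lo_five]
      unfold endX
      split_ifs with h0
      · subst h0
        exact piPerc_mid_zero_two_le_blockAbar'' p hb (hw0 rfl) _
      · obtain h1 | h2 : a₀ = 1 ∨ a₀ = 2 := by
          fin_cases a₀
          · exact absurd rfl h0
          · exact Or.inl rfl
          · exact Or.inr rfl
        · subst h1
          obtain ⟨κ', hκ'⟩ := (zdGraph_adj_iff_stepVec _ _).1 (hw1 rfl)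
          rw [blockAbar''_of_ne _ _ (by decide)]
          exact piPerc_mid_one_two_le_blockAbar' p hb hκ' _
        · subst h2
          rw [blockAbar''_of_ne _ _ (by decide)]
          exact piPerc_mid_two_two_le_blockAbar' p hb _
    · rw [endEv_up_two, endEv_up_one, endEv_up_three]
      exact NobleBlocks.piPerc_end_two_le_blockPE p htx hzx _

/-- **Rows `(a, 0)` against `Ā''`** (`= Ā'` off `(0,2)`).
[cite: FitznerVanDerHofstad2017, §6.1 "Case a = 0 / a = 1 / a ≥ 2", "Case a = 0, b ≥ 2" (arXiv:1506.07977v2 pp. 58–59); App. B (p. 78); (4.29) (p. 38)] -/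
theorem nonempty_jPkg_end_zero'' (κ : Fin d × Bool)
    (hb : (b (Fin.last (M + 1))).2 = (b (Fin.last (M + 1))).1 + stepVec κ) (a₀ : Fin 3)
    (ha : a (Fin.last (M + 1)) = Sum.inl a₀) (hc : c = Sum.inl 0) :
    Nonempty (JPkg p (jctx M x b w t z a τ (Fin.last (M + 1))) (JFacts M x b w t z a c τ)
      (blockAbar'' (Letters.perc d p) κ a₀ 0 (b (Fin.last (M + 1))).1 (w (Fin.last (M + 1))) (t (Fin.last (M + 1)))
          (z (Fin.last (M + 1))) *
        blockPE (Letters.perc d p) 0 (t (Fin.last (M + 1)) - x) (z (Fin.last (M + 1)) - x))) := by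
  rw [blockAbar''_of_ne _ _ (fun h => absurd h.2 (by decide))]
  exact nonempty_jPkg_end_zero p M x b w t z a c τ κ hb a₀ ha hc

/-- **Rows `(a, 1)` against `Ā''`** (`= Ā'` off `(0,2)`).
[cite: FitznerVanDerHofstad2017, §6.1 "Case a = 0 / a = 1 / a ≥ 2", "Case a = 0, b ≥ 2" (arXiv:1506.07977v2 pp. 58–59); App. B (p. 78); (4.29) (p. 38)] -/
theorem nonempty_jPkg_end_one'' (κ : Fin d × Bool)
    (hb : (b (Fin.last (M + 1))).2 = (b (Fin.last (M + 1))).1 + stepVec κ) (a₀ : Fin 3)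
    (ha : a (Fin.last (M + 1)) = Sum.inl a₀) (hc : c = Sum.inl 1) :
    Nonempty (JPkg p (jctx M x b w t z a τ (Fin.last (M + 1))) (JFacts M x b w t z a c τ)
      (blockAbar'' (Letters.perc d p) κ a₀ 1 (b (Fin.last (M + 1))).1 (w (Fin.last (M + 1))) (t (Fin.last (M + 1)))
          (z (Fin.last (M + 1))) *
        blockPE (Letters.perc d p) 1 (t (Fin.last (M + 1)) - x) (z (Fin.last (M + 1)) - x))) := by
  rw [blockAbar''_of_ne _ _ (fun h => absurd h.2 (by decide))]
  exact nonempty_jPkg_end_one p M x b w t z a c τ κ hb a₀ ha hc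

/-- **The last-junction package for the `★`-extended terminal tables on `Ā''`**: twin of
`NobleBoundsNEndC1.nonempty_jPkg_end_starA` for `A := starA Ā'' (secEA Ā'' 2)`; the hypothesis `pkg` of
`prod_bondJ_mul_piPerc_jwCover_le_chain_of_packages` at the last junction for the `Ā''` tables.
[cite: FitznerVanDerHofstad2017, §6.1 (6.4) and "Case b = 0, 1, 2", "Case a = 0, b ≥ 2" (arXiv:1506.07977v2 pp. 58–59); §5.1 "Elements
of the bounds" (p. 49); Lemma 6.1 (6.51) (p. 66)] -/
theorem nonempty_jPkg_end_starA'' (κ : Fin d × Bool) (hb : (b (Fin.last (M + 1))).2 = (b (Fin.last (M + 1))).1 + stepVec κ) :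
    Nonempty (JPkg p (jctx M x b w t z a τ (Fin.last (M + 1))) (JFacts M x b w t z a c τ)
      (BlockSummation.starA (blockAbar'' (Letters.perc d p)) (BlockSummation.secEA (blockAbar'' (Letters.perc d p)) 2) κ (a (Fin.last (M + 1))) c
          (b (Fin.last (M + 1))).1 (w (Fin.last (M + 1))) (t (Fin.last (M + 1))) (z (Fin.last (M + 1))) *
        BlockSummation.starS (blockPE (Letters.perc d p)) c (t (Fin.last (M + 1)) - x) (z (Fin.last (M + 1)) - x))) := by
  rw [secEA_blockAbar''_two]
  rcases c with c₀ | u₁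
  · rcases ha : a (Fin.last (M + 1)) with a₀ | u₀
    · rw [BlockSummation.starA_inl_inl, BlockSummation.starS_inl]
      fin_cases c₀
      · exact nonempty_jPkg_end_zero'' p M x b w t z a _ τ κ hb a₀ ha rfl
      · exact nonempty_jPkg_end_one'' p M x b w t z a _ τ κ hb a₀ ha rfl
      · exact nonempty_jPkg_end_two'' p M x b w t z a _ τ κ hb a₀ ha rfl
    · rw [BlockSummation.starA_inr_inl, BlockSummation.starS_inl]
      by_cases h1 : c₀ = 1
      · subst h1
        exact nonempty_jPkg_end_star_one p M x b w t z a _ τ κ hb u₀ ha rfl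
      · exact nonempty_jPkg_end_star p M x b w t z a _ τ κ hb u₀ ha c₀ rfl h1
  · exact nonempty_jPkg_end_inr p M x b w t z a _ τ u₁ rfl _

end EndJunction

end Literature.Probability.FitznerVanDerHofstad2017
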